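import Literature.Probability.LatticeModels.KCSignConfig
import HarnessLib

/-!
# The sign-condition argument at one mesh: the lattice objects of a configuration

Topic `Literature/Probability/LatticeModels`. Given a continuum configuration
`cfg : KCSignConfig Ω G Bad` (`KCSignConfig.lean`), a mesh `δ`, a hole-free free set `Λ` and an
end length `μ`, this file builds the lattice objects of the sign-condition argument
(Chelkak–Smirnov 2012, proof of Thm. 6.1) — the two ends (`ℓ¹`-nearest frozen sites to
`z₀ e / δ`, `KCEndRun.lean`), the contour and its avoided plaquettes (`KCSignContour.lean`), the
seed plaquette and the reachable region `D` — and verifies, under explicit smallness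
assumptions on `δ` and the bulk-coverage / visibility hypotheses at this mesh, the geometric
facts about them that the lattice inequality `kc_sign_condition_ineq'` consumes. Everything is
in lattice units (continuum objects divided by `δ`).

All `[folklore]` glue; no named fact.

## References

* D. Chelkak, S. Smirnov, Invent. Math. 189 (2012) = arXiv:0910.2045, proof of Thm. 6.1, Remark 6.3. [ChelkakSmirnov2012Ising]
-/

noncomputable section

open Set Metric

namespace Literature.Probability.LatticeModels

open Site WeakBeurling

/-! ### Scaling between continuum and lattice units -/

section Scaling

variable {δ : ℝ}

/-- `l1norm` of a real multiple. [folklore] -/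
theorem l1norm_real_smul (t : ℝ) (v : ℂ) : l1norm ((t : ℂ) * v) = |t| * l1norm v := by
  simp only [l1norm, Complex.mul_re, Complex.mul_im, Complex.ofReal_re, Complex.ofReal_im, zero_mul, sub_zero, add_zero,
    abs_mul]
  ring

/-- `l1norm` is nonnegative. [folklore] -/
theorem l1norm_nonneg (v : ℂ) : 0 ≤ l1norm v := by unfold l1norm; positivity

/-- `l1norm (-v) = l1norm v`. [folklore] -/
theorem l1norm_neg (v : ℂ) : l1norm (-v) = l1norm v := by simp [l1norm, abs_neg]

/-- Scaling an `ℓ¹` distance to lattice units: `l1norm (x/δ - y/δ) = l1norm (x - y) / δ`. [folklore] -/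
theorem l1norm_div_sub_div (hδ : 0 < δ) (x y : ℂ) : l1norm (x / δ - y / δ) = l1norm (x - y) / δ := by
  have : x / (δ : ℂ) - y / δ = ((δ⁻¹ : ℝ) : ℂ) * (x - y) := by push_cast; field_simp
  rw [this, l1norm_real_smul, abs_of_pos (inv_pos.2 hδ), div_eq_inv_mul]

/-- The `ℓ¹` distance of a site to a scaled point, in continuum units. [folklore] -/
theorem l1dist_div (hδ : 0 < δ) (v : Site 2) (x : ℂ) : l1dist v (x / δ) = l1norm ((δ : ℂ) * toComplex v - x) / δ := by
  rw [l1dist_eq_l1norm, ← l1norm_div_sub_div hδ]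
  have hδ' : (δ : ℂ) ≠ 0 := Complex.ofReal_ne_zero.2 hδ.ne'
  rw [mul_div_cancel_left₀ _ hδ']

/-- Euclidean distances scale. [folklore] -/
theorem dist_div_div (hδ : 0 < δ) (x y : ℂ) : dist (x / δ) (y / δ) = dist x y / δ := by
  rw [dist_eq_norm, dist_eq_norm, ← sub_div, norm_div, Complex.norm_real, Real.norm_eq_abs, abs_of_pos hδ]

/-- The scaling homeomorphism to lattice units is continuous. [folklore] -/
theorem continuous_div_const' (δ : ℝ) : Continuous fun x : ℂ => x / δ := continuous_id.div_const _

end Scaling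

namespace KCSignConfig

variable {Ω G Bad : Set ℂ} (cfg : KCSignConfig Ω G Bad)

/-! ### Compactness of the auxiliary sets -/

/-- Closed `ℓ¹`-diamonds are compact. [folklore] -/
theorem isCompact_l1ball (z : ℂ) (r : ℝ) : IsCompact {w : ℂ | l1norm (w - z) ≤ r} := by
  refine (isCompact_closedBall z r).of_isClosed_subset ?_ fun w hw => ?_
  · have : {w : ℂ | l1norm (w - z) ≤ r} = (fun w : ℂ => |(w - z).re| + |(w - z).im|) ⁻¹' Iic r := by
      ext w; simp [l1norm]
    rw [this]
    exact isClosed_Iic.preimage (by fun_prop)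
  · rw [mem_closedBall, dist_eq_norm]
    exact (norm_le_l1norm _).trans hw

/-- The middle is compact. [folklore] -/
theorem isCompact_Mset : IsCompact cfg.Mset := by
  refine ((isCompact_range cfg.M₁.continuous).union ?_).union (isCompact_range cfg.M₂.continuous)
  rw [segment_eq_image']
  exact isCompact_Icc.image (by fun_prop)

/-! ### The lattice objects at mesh `δ` -/

section Scale

variable (δ : ℝ) (Λ : Finset (Site 2)) (μ : ℝ)

/-- The base points in lattice units. [folklore] -/
def Zl (e : Fin 2) : ℂ := cfg.z₀ e / δ

/-- The `ℓ¹`-nearest frozen site to the base point `Z_e` (a choice). [folklore] -/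
def aEnd (e : Fin 2) : Site 2 := Classical.choose (exists_min_l1dist Λ (cfg.Zl δ e))

/-- Specification of `aEnd`: frozen and `ℓ¹`-nearest. [folklore] -/
theorem aEnd_spec (e : Fin 2) : cfg.aEnd δ Λ e ∉ Λ ∧ ∀ a' : Site 2, a' ∉ Λ → l1dist (cfg.aEnd δ Λ e) (cfg.Zl δ e) ≤ l1dist a' (cfg.Zl δ e) :=
  Classical.choose_spec (exists_min_l1dist Λ (cfg.Zl δ e))

/-- The `ℓ¹` distance of the end from its base point (lattice units). [folklore] -/
def mEnd (e : Fin 2) : ℝ := l1dist (cfg.aEnd δ Λ e) (cfg.Zl δ e)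

/-- The run direction of end `e` (a choice from `exists_endRun_sideTouch`). [folklore] -/
def kDir (e : Fin 2) : Fin 4 := Classical.choose (exists_endRun_sideTouch Λ (cfg.Zl δ e) (cfg.aEnd_spec δ Λ e).2)

/-- The corner index of the run's first plaquette `c₀^e = faceAt a_e j₁^e` (a choice). [folklore] -/
def jOne (e : Fin 2) : Fin 4 :=
  Classical.choose (Classical.choose_spec (exists_endRun_sideTouch Λ (cfg.Zl δ e) (cfg.aEnd_spec δ Λ e).2))

/-- Specification of the run: free lateral half-boxes and the `ℓ¹` estimate of the run centres. [folklore] -/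
theorem endRun_spec (e : Fin 2) :
    (∀ i : ℕ, 8 ≤ i → 2 * ((i : ℝ) + 1) ≤ cfg.mEnd δ Λ e → ∀ m : Fin 4, (m = cfg.kDir δ Λ e + 1 ∨ m = cfg.kDir δ Λ e + 3) →
        ∀ f ∈ flatHalfBox m (runPt (faceAt (cfg.aEnd δ Λ e) (cfg.jOne δ Λ e)) (cfg.kDir δ Λ e) i) (i / 8) (i / 8),
          ∀ j : Fin 4, SideTouch Λ f j) ∧
      (∀ n : ℕ, 2 * (n : ℝ) + 1 ≤ cfg.mEnd δ Λ e →
        l1norm (plaqCentre (runPt (faceAt (cfg.aEnd δ Λ e) (cfg.jOne δ Λ e)) (cfg.kDir δ Λ e) n) - cfg.Zl δ e) ≤ cfg.mEnd δ Λ e - n) :=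
  Classical.choose_spec (Classical.choose_spec (exists_endRun_sideTouch Λ (cfg.Zl δ e) (cfg.aEnd_spec δ Λ e).2))

/-- The end length in lattice units, `L = ⌊μ/δ⌋`. [folklore] -/
def Lend (δ μ : ℝ) : ℕ := ⌊μ / δ⌋₊

/-- The length of the straight run kept in the contour, `N₀ = 2L + 2`. [folklore] -/
def Nrun (δ μ : ℝ) : ℕ := 2 * Lend δ μ + 2

/-- The middle paths in lattice units. [folklore] -/
def M₁l : Path (cfg.Zl δ 0) (cfg.q₁ / δ) := cfg.M₁.map (continuous_div_const' δ)

/-- The middle paths in lattice units. [folklore] -/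
def M₂l : Path (cfg.q₂ / δ) (cfg.Zl δ 1) := cfg.M₂.map (continuous_div_const' δ)

/-- The contour at mesh `δ`. [folklore] -/
def contourL : Set ℂ :=
  contour (cfg.aEnd δ Λ) (cfg.kDir δ Λ) (cfg.jOne δ Λ) (Nrun δ μ) (cfg.Zl δ) (cfg.M₁l δ) (cfg.M₂l δ)

/-- The avoided plaquettes at mesh `δ`. [folklore] -/
def CsetL : Set (Site 2) :=
  Cset (cfg.aEnd δ Λ) (cfg.kDir δ Λ) (cfg.jOne δ Λ) (Nrun δ μ) (cfg.Zl δ) (cfg.M₁l δ) (cfg.M₂l δ)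

/-- The seed plaquette. [folklore] -/
def f₀ : Site 2 := plaqOf (cfg.zStar / δ)

/-- **The region `D`**: plaquettes reachable from the seed by touching steps off the avoided set. [cite: ChelkakSmirnov2012Ising, proof of Thm. 6.1 (D^δ)] -/
def Dreg : Finset (Site 2) := touchReach Λ (cfg.CsetL δ Λ μ) (cfg.f₀ δ)

end Scale

/-! ### The admissible range of the parameters -/

/-- The largest admissible end length `μ`. [folklore] -/
def μmax : ℝ := min (min (cfg.mInf 0) (cfg.mInf 1) / 8) (min (cfg.dR / 4) (8 * cfg.slack))

/-- The largest admissible mesh for end length `μ`. [folklore] -/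
def δmax (μ : ℝ) : ℝ := min (min (μ / 16) (cfg.κ / 100)) (min (min (cfg.slack / 8) (cfg.rM / 8)) (min (cfg.d₀ / 8) (cfg.dR / 12)))

variable {cfg}

/-- Unpacking `μ ≤ μmax`. [folklore] -/
theorem le_of_le_μmax {μ : ℝ} (h : μ ≤ cfg.μmax) :
    (∀ e, μ ≤ cfg.mInf e / 8) ∧ μ ≤ cfg.dR / 4 ∧ μ ≤ 8 * cfg.slack := by
  unfold μmax at h
  have h1 := min_le_left (min (cfg.mInf 0) (cfg.mInf 1) / 8) (min (cfg.dR / 4) (8 * cfg.slack))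
  have h2 := min_le_right (min (cfg.mInf 0) (cfg.mInf 1) / 8) (min (cfg.dR / 4) (8 * cfg.slack))
  have h3 := min_le_left (cfg.dR / 4) (8 * cfg.slack)
  have h4 := min_le_right (cfg.dR / 4) (8 * cfg.slack)
  have h5 := min_le_left (cfg.mInf 0) (cfg.mInf 1)
  have h6 := min_le_right (cfg.mInf 0) (cfg.mInf 1)
  refine ⟨fun e => ?_, by linarith, by linarith⟩
  fin_cases e <;> simp <;> linarith

/-- Unpacking `δ ≤ δmax μ`. [folklore] -/
theorem le_of_le_δmax {μ δ : ℝ} (h : δ ≤ cfg.δmax μ) :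
    δ ≤ μ / 16 ∧ δ ≤ cfg.κ / 100 ∧ δ ≤ cfg.slack / 8 ∧ δ ≤ cfg.rM / 8 ∧ δ ≤ cfg.d₀ / 8 ∧ δ ≤ cfg.dR / 12 := by
  unfold δmax at h
  refine ⟨?_, ?_, ?_, ?_, ?_, ?_⟩ <;>
  linarith [min_le_left (min (μ / 16) (cfg.κ / 100)) (min (min (cfg.slack / 8) (cfg.rM / 8)) (min (cfg.d₀ / 8) (cfg.dR / 12))),
    min_le_right (min (μ / 16) (cfg.κ / 100)) (min (min (cfg.slack / 8) (cfg.rM / 8)) (min (cfg.d₀ / 8) (cfg.dR / 12))),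
    min_le_left (μ / 16) (cfg.κ / 100), min_le_right (μ / 16) (cfg.κ / 100),
    min_le_left (min (cfg.slack / 8) (cfg.rM / 8)) (min (cfg.d₀ / 8) (cfg.dR / 12)),
    min_le_right (min (cfg.slack / 8) (cfg.rM / 8)) (min (cfg.d₀ / 8) (cfg.dR / 12)),
    min_le_left (cfg.slack / 8) (cfg.rM / 8), min_le_right (cfg.slack / 8) (cfg.rM / 8),
    min_le_left (cfg.d₀ / 8) (cfg.dR / 12), min_le_right (cfg.d₀ / 8) (cfg.dR / 12)]

/-- `μmax` is positive. [folklore] -/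
theorem μmax_pos : 0 < cfg.μmax := by
  unfold μmax
  have := cfg.mInf_pos 0; have := cfg.mInf_pos 1; have := cfg.dR_pos; have := cfg.slack_pos
  positivity

/-- `δmax μ` is positive for positive `μ`. [folklore] -/
theorem δmax_pos {μ : ℝ} (hμ : 0 < μ) : 0 < cfg.δmax μ := by
  unfold δmax
  have := cfg.κ_pos; have := cfg.slack_pos; have := cfg.rM_pos; have := cfg.d₀_pos; have := cfg.dR_pos
  positivity

/-! ### The standing hypotheses at one mesh -/

/-- **The standing hypotheses of the one-mesh argument**: admissible `μ` and `δ`, a hole-free free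
set, bulk coverage of `Kbulk μ` (all its sites free) and visibility at tolerance `μ/8` of the
boundary points used (the touching points of the two end diamonds and a boundary point near the
seed). [folklore] -/
structure ScaleHyp (cfg : KCSignConfig Ω G Bad) (δ : ℝ) (Λ : Finset (Site 2)) (μ : ℝ) : Prop where
  μ_pos : 0 < μ
  μ_le : μ ≤ cfg.μmax
  δ_pos : 0 < δ
  δ_le : δ ≤ cfg.δmax μ
  holeFree : HoleFree (Λ : Set (Site 2))
  bulk : ∀ v : Site 2, (δ : ℂ) * toComplex v ∈ cfg.Kbulk μ → v ∈ Λ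
  vis_end : ∀ e, ∃ b : Site 2, b ∉ Λ ∧ l1norm ((δ : ℂ) * toComplex b - cfg.z₀ e) ≤ cfg.mInf e + μ / 8
  vis_seed : ∃ b : Site 2, b ∉ Λ ∧ dist ((δ : ℂ) * toComplex b) cfg.zStar ≤ 101 * cfg.κ

namespace ScaleHyp

variable {δ μ : ℝ} {Λ : Finset (Site 2)} (H : ScaleHyp cfg δ Λ μ)
include H

/-- `δ ≤ μ/16`. [folklore] -/
theorem δ_le_μ : δ ≤ μ / 16 := (le_of_le_δmax H.δ_le).1

/-- `δ ≤ κ/100`. [folklore] -/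
theorem δ_le_κ : δ ≤ cfg.κ / 100 := (le_of_le_δmax H.δ_le).2.1

/-- `δ ≤ slack/8`. [folklore] -/
theorem δ_le_slack : δ ≤ cfg.slack / 8 := (le_of_le_δmax H.δ_le).2.2.1

/-- `δ ≤ rM/8`. [folklore] -/
theorem δ_le_rM : δ ≤ cfg.rM / 8 := (le_of_le_δmax H.δ_le).2.2.2.1

/-- `δ ≤ d₀/8`. [folklore] -/
theorem δ_le_d₀ : δ ≤ cfg.d₀ / 8 := (le_of_le_δmax H.δ_le).2.2.2.2.1

/-- `δ ≤ dR/12`. [folklore] -/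
theorem δ_le_dR : δ ≤ cfg.dR / 12 := (le_of_le_δmax H.δ_le).2.2.2.2.2

/-- `μ ≤ mInf e/8`. [folklore] -/
theorem μ_le_mInf (e : Fin 2) : μ ≤ cfg.mInf e / 8 := (le_of_le_μmax H.μ_le).1 e

/-- `μ ≤ dR/4`. [folklore] -/
theorem μ_le_dR : μ ≤ cfg.dR / 4 := (le_of_le_μmax H.μ_le).2.1

/-- `μ ≤ 8 slack`. [folklore] -/
theorem μ_le_slack : μ ≤ 8 * cfg.slack := (le_of_le_μmax H.μ_le).2.2

/-! ### The ends: `δ m_e` is within `μ/8` of `mInf e` -/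

/-- Upper bound: `δ · m_e ≤ mInf e + μ/8` (visibility). [folklore] -/
theorem δ_mul_mEnd_le (e : Fin 2) : δ * cfg.mEnd δ Λ e ≤ cfg.mInf e + μ / 8 := by
  obtain ⟨b, hb, hbd⟩ := H.vis_end e
  have hmin := (cfg.aEnd_spec δ Λ e).2 b hb
  rw [mEnd]
  have hb' : l1dist b (cfg.Zl δ e) = l1norm ((δ : ℂ) * toComplex b - cfg.z₀ e) / δ := by
    rw [Zl, l1dist_div H.δ_pos]
  calc δ * l1dist (cfg.aEnd δ Λ e) (cfg.Zl δ e) ≤ δ * l1dist b (cfg.Zl δ e) := mul_le_mul_of_nonneg_left hmin H.δ_pos.le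
    _ = l1norm ((δ : ℂ) * toComplex b - cfg.z₀ e) := by rw [hb', ← mul_div_assoc, mul_comm δ, mul_div_cancel_right₀ _ H.δ_pos.ne']
    _ ≤ cfg.mInf e + μ / 8 := hbd

/-- Lower bound: `mInf e - μ/8 < δ · m_e` (bulk coverage of the sub-diamond). [folklore] -/
theorem lt_δ_mul_mEnd (e : Fin 2) : cfg.mInf e - μ / 8 < δ * cfg.mEnd δ Λ e := by
  by_contra h
  push Not at h
  have ha := (cfg.aEnd_spec δ Λ e).1
  apply ha
  apply H.bulk
  -- `δ a_e` lies in the closed sub-diamond of radius `mInf e - μ/8`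
  have : l1norm ((δ : ℂ) * toComplex (cfg.aEnd δ Λ e) - cfg.z₀ e) = δ * cfg.mEnd δ Λ e := by
    rw [mEnd, Zl, l1dist_div H.δ_pos, ← mul_div_assoc, mul_comm δ, mul_div_cancel_right₀ _ H.δ_pos.ne']
  refine Or.inr (Set.mem_iUnion.2 ⟨e, ?_⟩)
  show l1norm ((δ : ℂ) * toComplex (cfg.aEnd δ Λ e) - cfg.z₀ e) ≤ cfg.mInf e - μ / 8
  rw [this]; exact h

/-- The run length fits: `2 (L + 1) ≤ m_e` and `2 N₀ + 1 ≤ m_e` (lattice units). [folklore] -/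
theorem two_mul_Nrun_add_one_le (e : Fin 2) : 2 * (Nrun δ μ : ℝ) + 1 ≤ cfg.mEnd δ Λ e := by
  have hL : (Lend δ μ : ℝ) ≤ μ / δ := Nat.floor_le (div_nonneg H.μ_pos.le H.δ_pos.le)
  have hm := H.lt_δ_mul_mEnd e
  have hμ := H.μ_le_mInf e
  have hδμ := H.δ_le_μ
  have hδ := H.δ_pos
  -- `δ (2 N₀ + 1) = δ (4 L + 5) ≤ 4 μ + 5 δ ≤ mInf e - μ/8 < δ m_e`
  have key : δ * (2 * (Nrun δ μ : ℝ) + 1) ≤ cfg.mInf e - μ / 8 := by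
    have hLδ : δ * (Lend δ μ : ℝ) ≤ μ := by
      calc δ * (Lend δ μ : ℝ) ≤ δ * (μ / δ) := mul_le_mul_of_nonneg_left hL hδ.le
        _ = μ := by field_simp
    simp only [Nrun, Nat.cast_add, Nat.cast_mul, Nat.cast_ofNat]
    have : δ * (2 * (2 * (Lend δ μ : ℝ) + 2) + 1) = 4 * (δ * (Lend δ μ : ℝ)) + 5 * δ := by ring
    rw [this]
    linarith [H.μ_pos]
  by_contra h
  push Not at h
  have : δ * cfg.mEnd δ Λ e < δ * (2 * (Nrun δ μ : ℝ) + 1) := mul_lt_mul_of_pos_left h hδ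
  linarith

/-- `1 ≤ L`. [folklore] -/
theorem one_le_Lend : 1 ≤ Lend δ μ := by
  rw [Lend, Nat.one_le_floor_iff]
  rw [le_div_iff₀ H.δ_pos]
  linarith [H.δ_le_μ, H.μ_pos]

/-- `(L + 1) δ > μ`: the end length in lattice units exceeds `μ/δ - 1`. [folklore] -/
theorem μ_lt_succ_Lend_mul : μ < ((Lend δ μ : ℝ) + 1) * δ := by
  have := Nat.lt_floor_add_one (μ / δ)
  rw [Lend]
  rw [div_lt_iff₀ H.δ_pos] at this
  linarith

/-- `L δ ≤ μ`. [folklore] -/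
theorem Lend_mul_le : (Lend δ μ : ℝ) * δ ≤ μ := by
  have := Nat.floor_le (div_nonneg H.μ_pos.le H.δ_pos.le) (a := μ / δ)
  rw [Lend]
  rwa [le_div_iff₀ H.δ_pos] at this

/-! ### The contour lies in the middle and the two end zones -/

/-- The centre estimates of the run at `n = 0` and `n = N₀`. [folklore] -/
theorem l1norm_runCentre_le (e : Fin 2) {n : ℕ} (hn : n ≤ Nrun δ μ) :
    l1norm (plaqCentre (endRunPt (cfg.aEnd δ Λ) (cfg.kDir δ Λ) (cfg.jOne δ Λ) e n) - cfg.Zl δ e) ≤ cfg.mEnd δ Λ e - n := by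
  have h := (cfg.endRun_spec δ Λ e).2 n ?_
  · simpa [endRunPt] using h
  · have := H.two_mul_Nrun_add_one_le e
    have hn' : (n : ℝ) ≤ Nrun δ μ := by exact_mod_cast hn
    linarith

/-- In continuum units: a point `w'` (lattice units) with `l1norm (w' - Z_e) ≤ m_e - n` has
`l1norm (δ w' - z₀ e) ≤ mInf e + μ/8 - n δ`. [folklore] -/
theorem l1norm_scale_le {e : Fin 2} {w : ℂ} {t : ℝ} (hw : l1norm (w - cfg.Zl δ e) ≤ cfg.mEnd δ Λ e - t) :
    l1norm ((δ : ℂ) * w - cfg.z₀ e) ≤ cfg.mInf e + μ / 8 - t * δ := by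
  have hδ := H.δ_pos
  have h1 : l1norm ((δ : ℂ) * w - cfg.z₀ e) = δ * l1norm (w - cfg.Zl δ e) := by
    have hδ' : (δ : ℂ) ≠ 0 := Complex.ofReal_ne_zero.2 hδ.ne'
    have : (δ : ℂ) * w - cfg.z₀ e = ((δ : ℝ) : ℂ) * (w - cfg.Zl δ e) := by
      rw [Zl, mul_sub, mul_div_cancel₀ _ hδ']
    rw [this, l1norm_real_smul, abs_of_pos hδ]
  rw [h1]
  have := H.δ_mul_mEnd_le e
  nlinarith

/-- **The contour lies in `Mset/δ ∪ (E₀ ∪ E₁)/δ`**: every point `w` of the contour has `δ w` in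
the middle set or in one of the two end zones. [folklore] -/
theorem scale_mem_of_mem_contourL {w : ℂ} (hw : w ∈ cfg.contourL δ Λ μ) :
    (δ : ℂ) * w ∈ cfg.Mset ∨ ∃ e, l1norm ((δ : ℂ) * w - cfg.z₀ e) ≤ cfg.mInf e + μ / 8 := by
  have hδ := H.δ_pos
  have hend : ∀ e, w ∈ range (endPath (cfg.aEnd δ Λ) (cfg.kDir δ Λ) (cfg.jOne δ Λ) (Nrun δ μ) (cfg.Zl δ) e) →
      l1norm ((δ : ℂ) * w - cfg.z₀ e) ≤ cfg.mInf e + μ / 8 := by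
    intro e hw
    have h0 := H.l1norm_runCentre_le e (Nat.zero_le _)
    have hN := H.l1norm_runCentre_le e le_rfl
    simp only [Nat.cast_zero, sub_zero] at h0
    have hle := l1norm_le_of_mem_range_endPath (cfg.aEnd δ Λ) (cfg.kDir δ Λ) (cfg.jOne δ Λ) (Nrun δ μ) (cfg.Zl δ) e
      (by rw [mEnd] at h0; exact h0) (by rw [mEnd] at hN; exact hN.trans (by simp)) hw
    have := H.l1norm_scale_le (e := e) (w := w) (t := 0) (by rw [mEnd]; simpa using hle)
    simpa using this
  have hδ' : (δ : ℂ) ≠ 0 := Complex.ofReal_ne_zero.2 hδ.ne'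
  rcases hw with (hw | hw) | hw
  · exact Or.inr ⟨0, hend 0 hw⟩
  · left
    -- the middle: ranges of the scaled paths and the scaled flat piece
    rcases hw with (hw | hw) | hw
    · obtain ⟨t, rfl⟩ := hw
      refine Or.inl (Or.inl ⟨t, ?_⟩)
      have : (cfg.M₁l δ) t = cfg.M₁ t / δ := rfl
      rw [this, mul_div_cancel₀ _ hδ']
    · refine Or.inl (Or.inr ?_)
      rw [segment_eq_image'] at hw ⊢
      obtain ⟨θ, hθ, rfl⟩ := hw
      refine ⟨θ, hθ, ?_⟩
      show cfg.q₁ + θ • (cfg.q₂ - cfg.q₁) = δ * (cfg.q₁ / δ + θ • (cfg.q₂ / δ - cfg.q₁ / δ))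
      rw [Complex.real_smul, Complex.real_smul, mul_add, mul_div_cancel₀ _ hδ', ← sub_div, mul_left_comm, mul_div_cancel₀ _ hδ']
    · obtain ⟨t, rfl⟩ := hw
      refine Or.inr ⟨t, ?_⟩
      have : (cfg.M₂l δ) t = cfg.M₂ t / δ := rfl
      rw [this, mul_div_cancel₀ _ hδ']
  · exact Or.inr ⟨1, hend 1 hw⟩

/-- Points of the end zones and of the middle are far from the seed: at distance `> seedClear κ`. [folklore] -/
theorem dist_zStar_gt_of_mem_contourL {w : ℂ} (hw : w ∈ cfg.contourL δ Λ μ) : seedClear * cfg.κ < dist ((δ : ℂ) * w) cfg.zStar := by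
  rcases H.scale_mem_of_mem_contourL hw with h | ⟨e, he⟩
  · by_contra hle
    push Not at hle
    have hmem : (δ : ℂ) * w ∈ closedBall cfg.zStar (seedClear * cfg.κ) := by rwa [mem_closedBall]
    obtain ⟨h1, h2, h3⟩ := cfg.seedBall_mid _ hmem
    rcases h with (h | h) | h
    · exact h1 h
    · exact h3 h
    · exact h2 h
  · have hμ := H.μ_le_slack
    have := cfg.far_end_seed e _ (he.trans (by linarith))
    linarith [cfg.dR_pos]

/-- **The seed plaquette is not avoided.** [folklore] -/
theorem f₀_not_mem_CsetL : cfg.f₀ δ ∉ cfg.CsetL δ Λ μ := by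
  refine not_mem_Cset_of_dist _ _ _ _ _ _ _ fun w hw => ?_
  have hδ := H.δ_pos
  have hfar := H.dist_zStar_gt_of_mem_contourL hw
  -- the seed plaquette's centre is within one lattice unit of `zStar/δ`
  have hδ' : (δ : ℂ) ≠ 0 := Complex.ofReal_ne_zero.2 hδ.ne'
  have hc : dist (plaqCentre (cfg.f₀ δ)) (cfg.zStar / δ) ≤ 1 := dist_plaqCentre_le_of_mem_plaqClosedSq (mem_plaqClosedSq_plaqOf _)
  have hscale : dist (plaqCentre (cfg.f₀ δ)) w = dist ((δ : ℂ) * plaqCentre (cfg.f₀ δ)) ((δ : ℂ) * w) / δ := by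
    have := dist_div_div hδ ((δ : ℂ) * plaqCentre (cfg.f₀ δ)) ((δ : ℂ) * w)
    rwa [mul_div_cancel_left₀ _ hδ', mul_div_cancel_left₀ _ hδ'] at this
  have hscale0 : dist (plaqCentre (cfg.f₀ δ)) (cfg.zStar / δ) = dist ((δ : ℂ) * plaqCentre (cfg.f₀ δ)) cfg.zStar / δ := by
    have := dist_div_div hδ ((δ : ℂ) * plaqCentre (cfg.f₀ δ)) cfg.zStar
    rwa [mul_div_cancel_left₀ _ hδ'] at this
  rw [hscale, lt_div_iff₀ hδ, one_mul]
  rw [hscale0, div_le_iff₀ hδ, one_mul] at hc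
  have hκ := H.δ_le_κ
  have htri := dist_triangle ((δ : ℂ) * w) ((δ : ℂ) * plaqCentre (cfg.f₀ δ)) cfg.zStar
  have hsym : dist ((δ : ℂ) * w) ((δ : ℂ) * plaqCentre (cfg.f₀ δ)) = dist ((δ : ℂ) * plaqCentre (cfg.f₀ δ)) ((δ : ℂ) * w) :=
    dist_comm _ _
  have h712 : 712 * cfg.κ ≤ seedClear * cfg.κ := mul_le_mul_of_nonneg_right seedClear_ge cfg.κ_pos.le
  linarith [cfg.κ_pos]

/-- `D` misses the avoided set. [folklore] -/
theorem not_mem_CsetL_of_mem_Dreg {f : Site 2} (hf : f ∈ cfg.Dreg δ Λ μ) : f ∉ cfg.CsetL δ Λ μ :=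
  not_mem_avoid_of_touchReachable H.f₀_not_mem_CsetL (mem_touchReach_iff.1 hf)

/-! ### The middle region `Mid` and the shape of the avoided set -/

/-- Points of the scaled middle set scale back into `Mset`. [folklore] -/
theorem scale_mem_Mset_of_mem_midSet {w : ℂ} (hw : w ∈ midSet (cfg.Zl δ) (cfg.M₁l δ) (cfg.M₂l δ)) : (δ : ℂ) * w ∈ cfg.Mset := by
  have h := H.scale_mem_of_mem_contourL (Or.inl (Or.inr hw))
  -- re-run the middle branch of the previous proof directly
  have hδ := H.δ_pos
  have hδ' : (δ : ℂ) ≠ 0 := Complex.ofReal_ne_zero.2 hδ.ne'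
  rcases hw with (hw | hw) | hw
  · obtain ⟨t, rfl⟩ := hw
    refine Or.inl (Or.inl ⟨t, ?_⟩)
    have : (cfg.M₁l δ) t = cfg.M₁ t / δ := rfl
    rw [this, mul_div_cancel₀ _ hδ']
  · refine Or.inl (Or.inr ?_)
    rw [segment_eq_image'] at hw ⊢
    obtain ⟨θ, hθ, rfl⟩ := hw
    refine ⟨θ, hθ, ?_⟩
    show cfg.q₁ + θ • (cfg.q₂ - cfg.q₁) = δ * (cfg.q₁ / δ + θ • (cfg.q₂ / δ - cfg.q₁ / δ))
    rw [Complex.real_smul, Complex.real_smul, mul_add, mul_div_cancel₀ _ hδ', ← sub_div, mul_left_comm, mul_div_cancel₀ _ hδ']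
  · obtain ⟨t, rfl⟩ := hw
    refine Or.inr ⟨t, ?_⟩
    have : (cfg.M₂l δ) t = cfg.M₂ t / δ := rfl
    rw [this, mul_div_cancel₀ _ hδ']

/-- Distances of scaled points: `dist (δ x) (δ y) = δ dist x y`. [folklore] -/
theorem dist_scale (x y : ℂ) : dist ((δ : ℂ) * x) ((δ : ℂ) * y) = δ * dist x y := by
  rw [dist_eq_norm, dist_eq_norm, ← mul_sub, norm_mul, Complex.norm_real, Real.norm_eq_abs, abs_of_pos H.δ_pos]

/-- `l1norm` of scaled differences. [folklore] -/
theorem l1norm_scale (x y : ℂ) : l1norm ((δ : ℂ) * x - (δ : ℂ) * y) = δ * l1norm (x - y) := by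
  rw [← mul_sub, show ((δ : ℂ)) = ((δ : ℝ) : ℂ) from rfl, l1norm_real_smul, abs_of_pos H.δ_pos]

/-- **The middle predicate**: the scaled centre lies in `Kmid μ`. [folklore] -/
def Mid (_H : ScaleHyp cfg δ Λ μ) (f : Site 2) : Prop := (δ : ℂ) * plaqCentre f ∈ cfg.Kmid μ

/-- A plaquette whose centre is within one lattice unit of the scaled middle set is `Mid`. [folklore] -/
theorem mid_of_near_midSet {f : Site 2} {w : ℂ} (hw : w ∈ midSet (cfg.Zl δ) (cfg.M₁l δ) (cfg.M₂l δ))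
    (hd : dist (plaqCentre f) w ≤ 1) : H.Mid f := by
  refine Or.inr (mem_cthickening_of_dist_le _ ((δ : ℂ) * w) _ _ (H.scale_mem_Mset_of_mem_midSet hw) ?_)
  rw [H.dist_scale]
  calc δ * dist (plaqCentre f) w ≤ δ * 1 := mul_le_mul_of_nonneg_left hd H.δ_pos.le
    _ ≤ cfg.rM := by linarith [H.δ_le_rM, cfg.rM_pos]

/-- A plaquette whose centre has `l1norm (δ · centre - z₀ e) ≤ mInf e - μ/2` is `Mid`. [folklore] -/
theorem mid_of_l1norm_le {f : Site 2} {e : Fin 2} (h : l1norm ((δ : ℂ) * plaqCentre f - cfg.z₀ e) ≤ cfg.mInf e - μ / 2) : H.Mid f :=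
  Or.inl (Set.mem_iUnion.2 ⟨e, h⟩)

/-- **Avoided plaquettes have their centre in `G`** (so the Kadanoff–Ceva bound applies at exit targets). [folklore] -/
theorem scale_centre_mem_G_of_mem_CsetL {f : Site 2} (hf : f ∈ cfg.CsetL δ Λ μ) : (δ : ℂ) * plaqCentre f ∈ G := by
  obtain ⟨w, hwC, hd⟩ := exists_dist_le_of_mem_Cset _ _ _ _ _ _ _ hf
  have hdist : dist ((δ : ℂ) * plaqCentre f) ((δ : ℂ) * w) ≤ δ := by
    rw [H.dist_scale]; exact mul_le_of_le_one_right H.δ_pos.le hd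
  rcases H.scale_mem_of_mem_contourL hwC with h | ⟨e, he⟩
  · refine (cfg.mid_thick_subset (mem_cthickening_of_dist_le _ ((δ : ℂ) * w) _ _ h ?_)).2
    linarith [H.δ_le_rM, cfg.rM_pos]
  · refine cfg.endZone_subset e ?_
    show l1norm ((δ : ℂ) * plaqCentre f - cfg.z₀ e) ≤ cfg.mInf e + 2 * cfg.slack
    have htri : l1norm ((δ : ℂ) * plaqCentre f - cfg.z₀ e) ≤ l1norm ((δ : ℂ) * plaqCentre f - (δ : ℂ) * w) + l1norm ((δ : ℂ) * w - cfg.z₀ e) := by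
      have := l1norm_add_le ((δ : ℂ) * plaqCentre f - (δ : ℂ) * w) ((δ : ℂ) * w - cfg.z₀ e)
      rwa [sub_add_sub_cancel] at this
    have h2 : l1norm ((δ : ℂ) * plaqCentre f - (δ : ℂ) * w) ≤ 2 * δ := by
      refine (l1norm_le_two_mul_norm _).trans ?_
      rw [← dist_eq_norm]; linarith
    have h3 : μ ≤ 8 * cfg.slack := H.μ_le_slack
    have h4 : δ ≤ cfg.slack / 8 := H.δ_le_slack
    linarith [cfg.slack_pos]

/-- **The shape of the avoided set** (hypothesis `hcarry`): an avoided plaquette that is not `Mid`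
is one of the run plaquettes `c_i^e` with `i ≤ L`. [folklore] -/
theorem exists_eq_endRunPt_of_mem_CsetL_not_mid {f : Site 2} (hf : f ∈ cfg.CsetL δ Λ μ) (hmid : ¬ H.Mid f) :
    ∃ e : Fin 2, ∃ i : ℕ, i ≤ Lend δ μ ∧ f = endRunPt (cfg.aEnd δ Λ) (cfg.kDir δ Λ) (cfg.jOne δ Λ) e i := by
  have hδ := H.δ_pos
  rcases mem_Cset_cases _ _ _ _ _ _ _ hf with ⟨w, hwf, hw⟩ | ⟨e, w, hwf, hw⟩ | ⟨e, i, hi, rfl⟩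
  · exact absurd (H.mid_of_near_midSet hw (dist_plaqCentre_le_of_mem_plaqClosedSq hwf)) hmid
  · -- the connector of end `e`: `l1norm (w - Z_e) ≤ m_e - N₀`
    exfalso; apply hmid; apply H.mid_of_l1norm_le (e := e)
    have hN := H.l1norm_runCentre_le e (le_refl (Nrun δ μ))
    have hρ : 0 ≤ cfg.mEnd δ Λ e - (Nrun δ μ : ℕ) := by
      have := H.two_mul_Nrun_add_one_le e; linarith
    have hw' := l1norm_le_of_mem_connector (cfg.aEnd δ Λ) (cfg.kDir δ Λ) (cfg.jOne δ Λ) (Nrun δ μ) (cfg.Zl δ) e hN hρ hw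
    have hc : l1norm (plaqCentre f - cfg.Zl δ e) ≤ cfg.mEnd δ Λ e - ((Nrun δ μ : ℝ) - 2) := by
      have htri := l1norm_add_le (plaqCentre f - w) (w - cfg.Zl δ e)
      rw [sub_add_sub_cancel] at htri
      have h2 : l1norm (plaqCentre f - w) ≤ 2 := by
        refine (l1norm_le_two_mul_norm _).trans ?_
        rw [← dist_eq_norm]; linarith [dist_plaqCentre_le_of_mem_plaqClosedSq hwf]
      linarith
    have key := H.l1norm_scale_le hc
    have hL := H.μ_lt_succ_Lend_mul
    have hδμ := H.δ_le_μ
    simp only [Nrun, Nat.cast_add, Nat.cast_mul, Nat.cast_ofNat] at key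
    nlinarith
  · -- a run plaquette: either `i ≤ L`, or it is `Mid`
    by_cases hiL : i ≤ Lend δ μ
    · exact ⟨e, i, hiL, rfl⟩
    · exfalso; apply hmid; apply H.mid_of_l1norm_le (e := e)
      have hc := H.l1norm_runCentre_le e hi
      have key := H.l1norm_scale_le hc
      have hL := H.μ_lt_succ_Lend_mul
      have hi' : (Lend δ μ : ℝ) + 1 ≤ i := by exact_mod_cast Nat.lt_of_not_le hiL
      have hδμ := H.δ_le_μ
      nlinarith [H.δ_pos]

end ScaleHyp

end KCSignConfig

end Literature.Probability.LatticeModels
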